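import Summits.NavierStokesRegularity.NavierStokesRegularity.Theorems.ScenarioCensusRowF1IntStretchKill
import Summits.NavierStokesRegularity.NavierStokesRegularity.Theorems.ScenarioCensusRowF1FrozenTop
import HarnessLib

/-!
# LINE «integrated-stretch» port, part 5/5: §8 the BUDGET rows — `budgetOf`, `Row_F1ipb` / `rowF1ipb_holds`, `DivergentExcess` / `divergentExcess_holds`,
# `rowF1ip_of_rowF1ipb`; census KEYS `Row_F1ip` / `Row_F1ipb` + `_excluded`, floors

Re-homed for the scenario census (typer seat ns-census-typer-1 g8; the cells F1ip / F1ipb and the floors DP / DX are MEMBERS OF RECORD «DECIDED IN KERNEL IN FILES» of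
row F1 since census v1.76 (critic idea-crit-3 g7 PASS — no price 01:59:32Z; ref ns-census-ref g10 PRE-CHECK ✓ §15.8–10; lead-presearch label); this port makes them
TREE-decided): VERBATIM PORT of ns-idea-3 LINE 23 «integrated-stretch», `pub/ideators/ns-idea-3/lines/integrated-stretch/line-integrated-stretch.lean` sha16
1cd526fed4663244 (1567 l., lean check rc 0, 0 sorry), split for the 400-line rule into `ScenarioCensusRowF1IntStretch` (§1–§2) → `…IntStretchZoom` (§3–§5a) →
`…IntStretchTransfer` (§5b) → `…IntStretchKill` (§6–§7) → `…IntStretchBudget` (§8 + census KEYS).  Lean text VERBATIM in namespace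
`…Theorems.ScenarioCensus.IntegratedStretch` (the line's `…Cruxes.ScenarioCensusRowF1.IntegratedStretchLine` re-homed); port edits: the bracket lines `section
IntegralTransfer` / `end IntegralTransfer` dropped (no `variable`s; the section spans two parts), `@[conjecture]` on the residual `IpSlack` (≡ `ScenarioCensus.Row_F1`,
OPEN), four one-line docstrings added (gate lint); lemmas the line shares VERBATIM with the landed inviscid-top / frozen-top / columnar-top / stretched-top ports are
taken BY NAME (listed below).  Statements untouched.

No census VALUE is moved here (row F1 stays OPEN-WITH-LINE; the members become TREE-decided by name); NS regularity is NOT proved; `Row_F1` is untouched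
(zero movement, `ipSlack_iff_rowF1`); no summit statement is proved by this file. Lemmas that restate already-landed tree declarations are taken BY NAME (gate lint `dedup.landed`): `fderiv_smul_stPull_apply` = `InviscidTop.fderiv_smul_stPull_apply`, `fderiv_smul_stPull` = `InviscidTop.fderiv_smul_stPull`, `fderiv_fderiv_smul_stPull` = `InviscidTop.fderiv_fderiv_smul_stPull`, `tendsto_clm_of_tendsto_apply` = `InviscidTop.tendsto_clm_of_tendsto_apply`, `tendsto_fderiv_fderiv_apply_of_bound` = `InviscidTop.tendsto_fderiv_fderiv_apply_of_bound`, `tendsto_fderiv_fderiv_of_bound` = `InviscidTop.tendsto_fderiv_fderiv_of_bound`, `tendsto_fderiv_fderiv_of_typeI_seq_Ioo` = `InviscidTop.tendsto_fderiv_fderiv_of_typeI_seq_Ioo`, `sing_of_not_bounded` = `InviscidTop.sing_of_not_bounded`, `convect_curl_self` = `FrozenTop.convect_curl_self`, `fderiv3_smul_stPull` = `FrozenTop.fderiv3_smul_stPull`, `tendsto_fderiv3_of_typeI_seq_Ioo` = `FrozenTop.tendsto_fderiv3_of_typeI_seq_Ioo`, `radius_eq` = `FrozenTop.radius_eq`,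 `jointCond_everywhere₆` = `FrozenTop.jointCond_everywhere₄`, `tendsto_physicalTime` = `ColumnarTop.tendsto_physicalTime`, `eventually_fast` = `ColumnarTop.eventually_fast`, `sqrt_timeLag` = `StretchedTop.sqrt_timeLag`, `forall_of_forall_ne_zero` = `StretchedTop.forall_of_forall_ne_zero`, `cert_ineq_of_stretching` = `StretchedTop.cert_ineq_of_stretching`, `typeI_ancient_eq_zero_of_subcriticalStretching` = `StretchedTop.typeI_ancient_eq_zero_of_subcriticalStretching`, `exists_singularZoom_package₃` = `FrozenTop.exists_singularZoom_package₃`, `lapD_eq_zero_of_eq_zero` = `FrozenTop.lapD_eq_zero_of_eq_zero`.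
-/

-- the summit and its single problem share the name `NavierStokesRegularity` (D-0017 nested layout)
set_option linter.dupNamespace false

noncomputable section

open MeasureTheory Set Function Filter TopologicalSpace Metric
open scoped Topology NNReal ENNReal InnerProductSpace RealInnerProductSpace Laplacian

namespace Summit.NavierStokesRegularity.NavierStokesRegularity.Theorems.ScenarioCensus.IntegratedStretch

open Literature.Analysis Literature.Analysis.FluidPDE
open Summit.NavierStokesRegularity.NavierStokesRegularity.Theorems

/-! ## §8 The BUDGET rows — the full strength `θ < 1` of the stretching-certificate Liouville theorem: production is
charged only IN EXCESS OF the fraction `κ |u|²/ν` of the local Type-I rate (`|u|²/ν ≤ M²/(T − t)` on a Type-I(`M`)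
solution, so the free allowance is at most `κM² · |ω|²/(T − t)`, `κM² < 1`: SUB-SELF-SIMILAR production of the fast
fluid is free).  WEAKER hypothesis than row F1ip (`κ = 0`), same conclusion; the read-out stays weight-6 and
TIME-INDEPENDENT, so the transfer tool applies verbatim. -/

/-- **Budget read-out** (weight 6): `⟪curl L, L (curl L)⟫ − κ ‖v‖² ‖curl L‖²` — production net of the allowance
`κ |v|² |ω|²` (`ν`-normalised variables). -/
def budgetOf (κ : ℝ) (v : E3) (L : E3 →L[ℝ] E3) (_H : Hess) (_K : E3 →L[ℝ] E3) : ℝ :=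
  ⟪curlCLM L, L (curlCLM L)⟫ - κ * (‖v‖ ^ 2 * ‖curlCLM L‖ ^ 2)

/-- Weight-6 homogeneity of the budget read-out (for positive scalings). -/
theorem budgetOf_smul {a : ℝ} (ha : 0 < a) (κ : ℝ) (v : E3) (L : E3 →L[ℝ] E3) (H : Hess) (K : E3 →L[ℝ] E3) :
    budgetOf κ (a • v) (a ^ 2 • L) (a ^ 3 • H) (a ^ 4 • K) = a ^ 6 * budgetOf κ v L H K := by
  simp only [budgetOf, _root_.smul_apply, ContinuousLinearMap.map_smul, smul_smul,
    real_inner_smul_left, real_inner_smul_right, norm_smul, Real.norm_eq_abs, abs_of_pos ha,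
    abs_of_pos (pow_pos ha 2)]
  ring

/-- The read-out `budgetOf κ` is continuous. -/
theorem continuous_budgetOf (κ : ℝ) :
    Continuous fun q : E3 × (E3 →L[ℝ] E3) × Hess × (E3 →L[ℝ] E3) => budgetOf κ q.1 q.2.1 q.2.2.1 q.2.2.2 := by
  have hc : Continuous (curlCLM : (E3 →L[ℝ] E3) →L[ℝ] E3) := curlCLM.continuous
  have hL : Continuous fun q : E3 × (E3 →L[ℝ] E3) × Hess × (E3 →L[ℝ] E3) => curlCLM q.2.1 :=
    hc.comp continuous_snd.fst
  have h3 : Continuous fun q : E3 × (E3 →L[ℝ] E3) × Hess × (E3 →L[ℝ] E3) => q.2.1 (curlCLM q.2.1) :=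
    continuous_snd.fst.clm_apply hL
  exact (hL.inner h3).sub (continuous_const.mul ((continuous_fst.norm.pow 2).mul (hL.norm.pow 2)))

/-- `budgetOf` vanishes at the zero datum. -/
theorem budgetOf_zero (κ : ℝ) : budgetOf κ 0 0 0 0 = 0 := by simp [budgetOf]

/-- The budget read-out of `(v, ∇v, ∇²v, K)(x)` is `⟪ω, (ω·∇)v⟫ − κ |v|² |ω|²` at `x`. -/
theorem budget_eq (κ : ℝ) (v : E3 → E3) (x : E3) :
    ⟪curl v x, convect (curl v) v x⟫ - κ * (‖v x‖ ^ 2 * ‖curl v x‖ ^ 2) =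
      budgetOf κ (v x) (fderiv ℝ v x) (fderiv ℝ (fderiv ℝ v) x) (lapD v x) := by
  rw [budgetOf, FrozenTop.convect_curl_self, curl_apply_eq]

/-- `ν`-normalisation: `ν³ w · budgetOf κ (u/ν, ∇u/ν, ∇²u/ν, K/ν) = w (⟪ω, (ω·∇)u⟫ − κ ν⁻¹ |u|² |ω|²)`. -/
theorem nu_readout_budgetOf {ν : ℝ} (hν : 0 < ν) (w κ : ℝ) (v : E3 → E3) (x : E3) :
    ν ^ 3 * w * budgetOf κ (ν⁻¹ • v x) (ν⁻¹ • fderiv ℝ v x) (ν⁻¹ • fderiv ℝ (fderiv ℝ v) x) (ν⁻¹ • lapD v x) =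
      w * (⟪curl v x, convect (curl v) v x⟫ - κ * (ν⁻¹ * ‖v x‖ ^ 2 * ‖curl v x‖ ^ 2)) := by
  rw [FrozenTop.convect_curl_self, curl_apply_eq]
  simp only [budgetOf, _root_.smul_apply, ContinuousLinearMap.map_smul, smul_smul,
    real_inner_smul_left, real_inner_smul_right, norm_smul, Real.norm_eq_abs, abs_inv, abs_of_pos hν]
  field_simp

/-- The **BUDGET INTEGRAND of the fast fluid**: `𝟙{t ∈ [0,T), Λ(t) < |u|} · √(T − t) ·
max(0, ⟪ω, (ω·∇)u⟫ − κ |u|² |ω|² / ν)` — production charged only above the local allowance `κ |u|² |ω|²/ν`. -/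
def budgetIntegrand (T ν κ : ℝ) (Λ : ℝ → ℝ) (u : ℝ → E3 → E3) : ℝ × E3 → ℝ≥0∞ :=
  {z : ℝ × E3 | z.1 ∈ Ico 0 T ∧ Λ z.1 < ‖u z.1 z.2‖}.indicator fun z =>
    ENNReal.ofReal (Real.sqrt (T - z.1) *
      max 0 (⟪curl (u z.1) z.2, convect (curl (u z.1)) (u z.1) z.2⟫
        - κ * (ν⁻¹ * ‖u z.1 z.2‖ ^ 2 * ‖curl (u z.1) z.2‖ ^ 2)))

/-- **Criterion row F1ipb** (BUDGET ROW; the exact frame of `Row_F1` plus: Type I with dimensionless constant `M`, an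
allowance `0 ≤ κ`, `κM² < 1`, and a finite budget integral of the fast fluid at some measurable subcritical level).
PROVED (`rowF1ipb_holds`).  `κ = 0` is row F1ip. -/
def Row_F1ipb : Prop :=
  ∀ (ν T : ℝ), 0 < ν → 0 < T → ∀ (u : ℝ → E3 → E3) (p : ℝ → E3 → ℝ),
    IsClassicalNSSolutionOn (Ico 0 T) ν 0 u p → IsLerayHopfOn T ν 0 (u 0) u →
    HasRapidSpatialDecay (u 0) → IsTypeIBlowup u T →
    (∃ (M κ : ℝ) (Λ : ℝ → ℝ), IsTypeIBlowupWith M ν u T ∧ 0 ≤ κ ∧ κ * M ^ 2 < 1 ∧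
      IsSubcriticalLevel T Λ ∧ Measurable Λ ∧ ∫⁻ z, budgetIntegrand T ν κ Λ u z < ⊤) →
    HasSmoothExtensionPast ν 0 u T

/-- **DIVERGENT EXCESS PRODUCTION** (floor, maximal frame): for a maximal Type-I(`M`) Clay blow-up, every allowance
`κ < 1/M²` and every measurable subcritical level, `∬_{|u| > Λ(t)} √(T − t) [⟪ω, Sω⟫ − κ|u|²|ω|²/ν]₊ dx dt = ∞`.
PROVED (`divergentExcess_holds`). -/
def DivergentExcess : Prop :=
  ∀ (ν T : ℝ), 0 < ν → 0 < T → ∀ (u : ℝ → E3 → E3) (p : ℝ → E3 → ℝ),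
    IsMaximalSmoothSolution ν 0 u p T → IsLerayHopfOn T ν 0 (u 0) u →
    HasRapidSpatialDecay (u 0) → ∀ M : ℝ, IsTypeIBlowupWith M ν u T →
    ∀ κ : ℝ, 0 ≤ κ → κ * M ^ 2 < 1 →
    ∀ Λ : ℝ → ℝ, IsSubcriticalLevel T Λ → Measurable Λ → ∫⁻ z, budgetIntegrand T ν κ Λ u z = ⊤

/-- `topIntegrand(budgetOf κ) = ofReal(√ν · ν⁻³) · budgetIntegrand` pointwise (kinematics). -/
theorem topIntegrand_budgetOf_eq {ν : ℝ} (hν : 0 < ν) (T κ : ℝ) (Λ : ℝ → ℝ) (u : ℝ → E3 → E3) (z : ℝ × E3) :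
    topIntegrand T ν Λ (fun v L H K => budgetOf κ v L H K) u z =
      ENNReal.ofReal (Real.sqrt ν * (ν ^ 3)⁻¹) * budgetIntegrand T ν κ Λ u z := by
  by_cases hz : z ∈ {z : ℝ × E3 | z.1 ∈ Ico 0 T ∧ Λ z.1 < ‖u z.1 z.2‖}
  · rw [topIntegrand, budgetIntegrand, indicator_of_mem hz, indicator_of_mem hz,
      ← ENNReal.ofReal_mul (mul_nonneg (Real.sqrt_nonneg ν) (inv_nonneg.2 (pow_nonneg hν.le 3)))]
    congr 1
    have key := nu_readout_budgetOf hν 1 κ (u z.1) z.2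
    rw [mul_one, one_mul] at key
    have hν3 : ν ^ 3 ≠ 0 := by positivity
    have hI : budgetOf κ (ν⁻¹ • u z.1 z.2) (ν⁻¹ • fderiv ℝ (u z.1) z.2) (ν⁻¹ • fderiv ℝ (fderiv ℝ (u z.1)) z.2)
        (ν⁻¹ • lapD (u z.1) z.2) = (ν ^ 3)⁻¹ * (⟪curl (u z.1) z.2, convect (curl (u z.1)) (u z.1) z.2⟫
          - κ * (ν⁻¹ * ‖u z.1 z.2‖ ^ 2 * ‖curl (u z.1) z.2‖ ^ 2)) := by
      rw [eq_inv_mul_iff_mul_eq₀ hν3]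
      exact key
    have hmax : ∀ P : ℝ, max 0 ((ν ^ 3)⁻¹ * P) = (ν ^ 3)⁻¹ * max 0 P := fun P => by
      rw [mul_max_of_nonneg _ _ (inv_nonneg.2 (pow_nonneg hν.le 3)), mul_zero]
    rw [hI, Real.sqrt_mul hν.le, hmax]
    ring
  · rw [topIntegrand, budgetIntegrand, indicator_of_notMem hz, indicator_of_notMem hz, mul_zero]

/-- `∫ topIntegrand(budgetOf κ) = ν^{-5/2} ∫ budgetIntegrand`. -/
theorem lintegral_topIntegrand_budgetOf_eq {ν : ℝ} (hν : 0 < ν) (T κ : ℝ) (Λ : ℝ → ℝ) (u : ℝ → E3 → E3) :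
    ∫⁻ z, topIntegrand T ν Λ (fun v L H K => budgetOf κ v L H K) u z =
      ENNReal.ofReal (Real.sqrt ν * (ν ^ 3)⁻¹) * ∫⁻ z, budgetIntegrand T ν κ Λ u z := by
  rw [← lintegral_const_mul' _ _ ENNReal.ofReal_ne_top]
  exact lintegral_congr fun z => topIntegrand_budgetOf_eq hν T κ Λ u z

/-- The Type-I time decay squared: `(−s) ‖W(s, y)‖² ≤ M²`. -/
theorem neg_mul_norm_sq_le {M : ℝ} {W : ℝ → E3 → E3} (hW : IsTypeIAncientMild M W) {s : ℝ} (hs : s < 0)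
    (y : E3) : (-s) * ‖W s y‖ ^ 2 ≤ M ^ 2 := by
  have hs0 : 0 < -s := neg_pos.2 hs
  have h1 := hW.norm_le hs y
  rw [le_div_iff₀ (Real.sqrt_pos.2 hs0)] at h1
  have h3 : 0 ≤ ‖W s y‖ * Real.sqrt (-s) := mul_nonneg (norm_nonneg _) (Real.sqrt_nonneg _)
  have h4 : (‖W s y‖ * Real.sqrt (-s)) ^ 2 ≤ M ^ 2 := pow_le_pow_left₀ h3 h1 2
  rw [mul_pow, Real.sq_sqrt hs0.le] at h4
  linarith

/-- **The budget row F1ipb is EXCLUDED** (in kernel).  Same engine as `rowF1ip_holds` with the read-out `budgetOf κ`;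
the transfer gives `⟪ω̃, ∇W ω̃⟫ ≤ κ |W|² |ω̃|²` on the zoom limit `W ∈ 𝒦_M`, whence, by the Type-I decay
`(−s)|W|² ≤ M²`, the sub-critical stretching bound `(−s)⟪∇W ω̃, ω̃⟫ ≤ κM² |ω̃|²` with `θ = κM² < 1` — the FULL
hypothesis of the tree's stretching-certificate Liouville theorem — so `W ≡ 0`: contradiction. -/
theorem rowF1ipb_holds : Row_F1ipb := by
  intro ν T hν hT u p hsol hLH hdec hTI htop
  obtain ⟨M, κ, Λ, hM, hκ, hθ, hΛ, hΛm, hfinP⟩ := htop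
  have hfin : ∫⁻ z, topIntegrand T ν Λ (fun v L H K => budgetOf κ v L H K) u z < ⊤ := by
    rw [lintegral_topIntegrand_budgetOf_eq hν T κ Λ u]
    exact ENNReal.mul_lt_top ENNReal.ofReal_lt_top hfinP
  apply hasSmoothExtensionPast_of_forall_exists_parabolicCylinder hν hT hsol hLH hdec
  intro x₀
  by_contra hno
  obtain ⟨α, β, R, c, W, hα, hβ, hR, hαR, hαν, hcpos, hclim, hW, hpt, hgrad, hhess, hlap, t, ht, y, hne⟩ :=
    FrozenTop.exists_singularZoom_package₃ hν hT hsol hLH hdec hM x₀ (InviscidTop.sing_of_not_bounded hno)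
  have hRd := integral_transfer₆ hν hT hsol hW hα hβ hαR hαν hcpos hclim hpt hgrad hhess hlap
    (Rd := fun v L H K => budgetOf κ v L H K) (continuous_budgetOf κ)
    (fun a ha v L H K => budgetOf_smul ha κ v L H K) hΛ hΛm hfin
  have hall := FrozenTop.jointCond_everywhere₄ hW (P := fun _ q => budgetOf κ q.1 q.2.1 q.2.2.1 q.2.2.2 ≤ 0)
    (fun _ => isClosed_le (continuous_budgetOf κ) continuous_const)
    (fun _ => by show budgetOf κ 0 0 0 0 ≤ 0; rw [budgetOf_zero]) hRd
  refine hne (StretchedTop.typeI_ancient_eq_zero_of_subcriticalStretching hθ hW (fun s hs y' => ?_) t ht y)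
  have hb : ⟪curl (W s) y', convect (curl (W s)) (W s) y'⟫ - κ * (‖W s y'‖ ^ 2 * ‖curl (W s) y'‖ ^ 2) ≤ 0 := by
    rw [budget_eq]
    exact hall s hs y'
  have hcomm : ⟪fderiv ℝ (W s) y' (curl (W s) y'), curl (W s) y'⟫ =
      ⟪curl (W s) y', convect (curl (W s)) (W s) y'⟫ := by
    rw [stretch_eq', ← stretch_eq]
  have hWb := neg_mul_norm_sq_le hW hs y'
  have hs0 : 0 < -s := neg_pos.2 hs
  have hb0 : 0 ≤ ‖curl (W s) y'‖ ^ 2 := sq_nonneg _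
  rw [hcomm]
  calc (-s) * ⟪curl (W s) y', convect (curl (W s)) (W s) y'⟫
      ≤ (-s) * (κ * (‖W s y'‖ ^ 2 * ‖curl (W s) y'‖ ^ 2)) :=
        mul_le_mul_of_nonneg_left (by linarith) hs0.le
    _ = κ * ‖curl (W s) y'‖ ^ 2 * ((-s) * ‖W s y'‖ ^ 2) := by ring
    _ ≤ κ * ‖curl (W s) y'‖ ^ 2 * M ^ 2 := mul_le_mul_of_nonneg_left hWb (mul_nonneg hκ hb0)
    _ = κ * M ^ 2 * ‖curl (W s) y'‖ ^ 2 := by ring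

/-- **The budget hypothesis is WEAKER than the production hypothesis** (in kernel): an integrably stretched top has a
finite budget integral for every allowance `κ ≥ 0` and every `ν > 0` (`[P − B]₊ ≤ [P]₊` for `B ≥ 0`). -/
theorem budget_lt_top_of_hasIntegrablyStretchedTop {T ν κ : ℝ} (hν : 0 < ν) (hκ : 0 ≤ κ) {Λ : ℝ → ℝ}
    {u : ℝ → E3 → E3} (h : HasIntegrablyStretchedTop T Λ u) : ∫⁻ z, budgetIntegrand T ν κ Λ u z < ⊤ := by
  refine lt_of_le_of_lt (lintegral_mono fun z => ?_) h
  by_cases hz : z ∈ {z : ℝ × E3 | z.1 ∈ Ico 0 T ∧ Λ z.1 < ‖u z.1 z.2‖}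
  · rw [budgetIntegrand, productionIntegrand, indicator_of_mem hz, indicator_of_mem hz]
    refine ENNReal.ofReal_le_ofReal (mul_le_mul_of_nonneg_left (max_le_max le_rfl ?_) (Real.sqrt_nonneg _))
    have hB : 0 ≤ κ * (ν⁻¹ * ‖u z.1 z.2‖ ^ 2 * ‖curl (u z.1) z.2‖ ^ 2) :=
      mul_nonneg hκ (mul_nonneg (mul_nonneg (inv_nonneg.2 hν.le) (sq_nonneg _)) (sq_nonneg _))
    linarith
  · rw [budgetIntegrand, productionIntegrand, indicator_of_notMem hz, indicator_of_notMem hz]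

/-- Row F1ip from the budget row at `κ = 0` (the dimensionless constant from `exists_isTypeIBlowupWith`). -/
theorem rowF1ip_of_rowF1ipb (h : Row_F1ipb) : Row_F1ip := by
  intro ν T hν hT u p hsol hLH hdec hTI htop
  obtain ⟨Λ, hΛ, hΛm, hfinP⟩ := htop
  obtain ⟨M, hM⟩ := exists_isTypeIBlowupWith hν hTI
  exact h ν T hν hT u p hsol hLH hdec hTI ⟨M, 0, Λ, hM, le_rfl, by rw [zero_mul]; exact zero_lt_one, hΛ, hΛm,
    budget_lt_top_of_hasIntegrablyStretchedTop hν le_rfl hfinP⟩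

/-- **The floor DIVERGENT EXCESS PRODUCTION holds.** -/
theorem divergentExcess_holds : DivergentExcess := by
  intro ν T hν hT u p hmax hLH hdec M hM κ hκ hθ Λ hΛ hΛm
  by_contra hne
  exact hmax.2 (rowF1ipb_holds ν T hν hT u p hmax.1 hLH hdec hM.isTypeIBlowup
    ⟨M, κ, Λ, hM, hκ, hθ, hΛ, hΛm, lt_top_iff_ne_top.2 hne⟩)

end Summit.NavierStokesRegularity.NavierStokesRegularity.Theorems.ScenarioCensus.IntegratedStretch

namespace Summit.NavierStokesRegularity.NavierStokesRegularity.Theorems.ScenarioCensus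

/-! ## Census KEYS (ns `…Theorems.ScenarioCensus`): the INTEGRATED-STRETCH sub-family of row F1 — TREE-decided members F1ip / F1ipb and floors -/

/-- **Cell F1ip** (row F1 frame VERBATIM + an integrably stretched top `∬_{|u|>Λ} √(T−t)[⟪ω,Sω⟫]₊ < ∞` at some measurable subcritical level ⇒ smooth extension past `T`): `:= IntegratedStretch.Row_F1ip`. DECIDED. -/
def Row_F1ip : Prop := IntegratedStretch.Row_F1ip
/-- F1ip is EXCLUDED (decided in the tree): `IntegratedStretch.rowF1ip_holds`. -/
theorem row_F1ip_excluded : Row_F1ip := IntegratedStretch.rowF1ip_holds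

/-- **Cell F1ipb** (budgeted top: Type I(`M`) + allowance `κ < 1/M²`, `∬ √(T−t)[⟪ω,Sω⟫ − κ|u|²|ω|²/ν]₊ < ∞` ⇒ extension): `:= IntegratedStretch.Row_F1ipb`. DECIDED. -/
def Row_F1ipb : Prop := IntegratedStretch.Row_F1ipb
/-- F1ipb is EXCLUDED (decided in the tree): `IntegratedStretch.rowF1ipb_holds`. -/
theorem row_F1ipb_excluded : Row_F1ipb := IntegratedStretch.rowF1ipb_holds

/-- **Floor DIVERGENT PRODUCTION** at the level of the census keys: `IntegratedStretch.divergentProduction_holds`. -/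
theorem row_F1_divergentProduction : IntegratedStretch.DivergentProduction := IntegratedStretch.divergentProduction_holds
/-- **Floor DIVERGENT EXCESS PRODUCTION** at the level of the census keys: `IntegratedStretch.divergentExcess_holds`. -/
theorem row_F1_divergentExcess : IntegratedStretch.DivergentExcess := IntegratedStretch.divergentExcess_holds
/-- Lattice edge at key level: F1ipb implies F1ip (`IntegratedStretch.rowF1ip_of_rowF1ipb`). -/
theorem row_F1ip_of_row_F1ipb : Row_F1ipb → Row_F1ip := IntegratedStretch.rowF1ip_of_rowF1ipb

end Summit.NavierStokesRegularity.NavierStokesRegularity.Theorems.ScenarioCensus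

end
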